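import Summits.QuantumFields.BalabanUV.Beta.GAN24.LegChainPush
import Summits.QuantumFields.BalabanUV.Beta.GAN24.DressedLegMultiplierColumnEnvelope
import Summits.QuantumFields.BalabanUV.Beta.GAN24.LegCompAssoc
import Summits.QuantumFields.BalabanUV.Beta.GAN24.CarrierSlotLegBottomKernel
import Summits.QuantumFields.BalabanUV.Beta.GAN24.Push4LegTelescopeComb
import Summits.QuantumFields.BalabanUV.Beta.HessKerCoDressedBmWall
import Summits.QuantumFields.BalabanUV.Beta.AxialDressingRootedBmHessian

/-!
# `BalabanUV.Beta.GAN24.CarrierKernelLegBlockL1` — binder row G-an2-4 ∕ (CONV-C), W-slot, the (α-0) parity re-cut, located crux (Q-L-k₀)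
# (RULING R-gan24p1-g36-1 (4)(B); OWNER `b2b-balaban-gan24-p1` gen 37, part 4 of the dressed-leg side — INPUT (E-b) OF THE (H1♮) WINDOW, DISCHARGED):
# **THE CARRIER's COMPOSITE KERNEL LEG `kChain (krow ∘ K♮ᴱ) m k` IS `T^B`-SIZED IN BLOCK MASS — ALL COLUMN FIBRES, UNIFORMLY IN THE PAIR OF LEVELS.**

NOT IN PRINT; OUR BOOKKEEPING ([folklore] re-indexing BY NAME over leaf-01 g74's `kChain`∕`krow`, leaf-01 g43's row dictionary `rowM (Πᵀ K̃_j Π) = −respStepBm`, asym1's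
`unitK_coDressKBmAt`, leaf-03 g55's `legChain_succ_left`, and the OWNER's parts 2 ∕ 3a ∕ 3b; 0 `def`, 0 cited facts, 0 `def … : Prop`, 0 sorry).  HONEST FRAMING (cell contract,
verbatim): «discharging `BetaPertH` makes Bałaban's UV stability UNCONDITIONAL — a real constructive-QFT result; it is NOT the continuum limit and NOT the Clay problem.»
HONEST DEPENDENCY (verbatim): «continuum YM on T⁴ ⇐ BetaPertH ∧ nine spine estimates (0/9 proved); BetaPertH ⇐ (D1) ∧ (D4) ∧ CAP+tail; G-an2-4 gates asym, D1 and NE2/3/4.»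

WHAT.  leaf-01 g74's k₀-fold window `LegPushDressedBoundBlockL1.locStencil₂_legChain_bsumPow_of_dressed_envelopes_of_blockL1` asks of the composite KERNEL leg of the carrier,
`kChain (fun j ↦ krow (K j) N) m k` (`krow K N α x″ f x = K (N•x″) x (inr α) f`; `kChain` composes the levels `m+k, …, m` through the FIELD columns, the free
column fibre `f` sitting at the LOWEST level `m`), ONLY its block mass `hl₁ : Σ_{t ∈ box (N^{k+1})} |kChain … α x″ f (N^{k+1}•c + t)| ≤ a_ρ·L^{d+1}·e^{−κ₀‖c − x″‖∞}`.
For the DRESSED unit step kernels of the socket, `K♮ᴱ_j := unitK (sfStep Lc j) (smStep d Lc j) (coDressKBmAt ρ Lc (KInvStep Lc j)) = Πᵀ_bm K̃_j Π_bm` (`unitK_coDressKBmAt`),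
THIS FILE PROVES that block mass with `a_ρ·L^{d+1} := K″·(k+1)·(Lc^{k+1})⁻¹` (`d = 3`, `2 ≤ Lc`, in-block root, ONE rate `κ₁ > 0`, ONE `K″ ≥ 0`, ALL `m k α x″ f c`):
* §1 (generic `d`, ANY family `l`): **`kChain_inl_eq_legChain`** — at a FIELD column the composite full-row leg IS leaf-17's `Push4Iter.legChain` of the field-column
  families (`kChain l m k α x″ (inl κ) x = legChain (j ↦ (α x″ α′ x′ ↦ l j α x″ (inl α′) x′)) m k α x″ κ x` — the two recursions coincide); `kChain_eq_kChain_update`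
  (the free fibre can be frozen into the level-`m` leg); **`kChain_succ_left`** (levelwise localised `l`, `1 ≤ N`): the chain ALSO unrolls at its FINE end —
  `kChain l m (k+1) α x″ f x = Σ′_{x′} Σ_{α′} legChain (…) (m+1) k α x″ α′ x′ · l m α′ x′ f x` (leaf-03's `legChain_succ_left`, i.e. `legComp_assoc`, through §1).
* §2 (generic `d`, `[NeZero Lc]`): **`krowInl_dressed_seq`** (`(j ↦ field columns of krow K♮ᴱ_j) = (j ↦ −respStepBmSeq ρ Lc j)`), `krow_dressed_inr` (the mm block is the
  UNDRESSED unit kernel's, part 3a), `decays_dressedStep` ∕ `klegDecay_krow_dressed`, **`kChain_dressed_inl`** (`= (−1)^{k+1} · legChain (respStepBmSeq ρ Lc) m k`),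
  **`kChain_dressed_inr_succ`** (`= (−1)^{k+1} · Σ′_{x′} Σ_{α′} legChain (respStepBmSeq ρ Lc) (m+1) k α x″ α′ x′ · K̃_m (Lc•x′) x (inr α′) (inr β)` — EXACTLY part 3b's object).
* §3 (`d = 3`, `2 ≤ Lc`): `sum_box_abs_mm_le` (a window of length one at a multiplier column = the K-slot's decay, block-summed) and
  **`exists_kChain_dressed_blockMass`**: `∃ κ₁ K″, 0 < κ₁ ∧ 0 ≤ K″ ∧ ∀ rr ∈ box, ∀ m k α x″ f c,
  Σ_{t ∈ box (3+1) (Lc^{k+1})} |kChain (j ↦ krow K♮ᴱ_j Lc) m k α x″ f (Lc^{k+1}•c + t)| ≤ K″·(k+1)·(Lc^{k+1})⁻¹·e^{−κ₁‖c − x″‖∞}` — field columns by part 2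
  (`DressedLegBlockL1Envelope.exists_legChain_blockL1_envelope`, p367009), multiplier columns by part 3b (`DressedLegMultiplierColumnEnvelope.exists_legChain_mmColumn_blockL1_envelope`,
  windows of length ≥ 2) and §3's one-block case (`KSlotAssembly.convCK_holds`), rates merged by `min`, constants by `+`.
So the window's `hl₁` is MET by the socket's own kernels with `a_ρ·L^{d+1} = K″·(k₀)·(Lc^{k₀})⁻¹` at window length `k₀ = k+1` — ONE POWER OF THE BLOCKING DOWN, linearly in the
window length (RULING (4)(B): the count's `L^{−1}` at `d = 3`).  What remains of (H1♮ on 𝒫) BY NAME: (E-c) the identification `hE` of the composite dressed SLOT legs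
`Push4Iter.legChain (colH ∘ K♮ᴱ) m k = r + d_zφ` with envelopes (leaf-01), (E-d) the socket call (`LegRowsOnRuledClass`) with GoodL := slot-charge ∧ slot-divergence rows and
`LegWindowArithmetic`.  Asserts NOTHING about Bałaban's tables beyond the tree's K-slot; NOT (H1♮); NOTHING of (Q-L) ∕ (C)sym discharged; NEVER «G-an2-4 closed» as (CONV-C);
NOT D1, NOT `BetaPertH`, NOT continuum, NOT Clay; not in print.  Unit `b2b-balaban-gan24-p1` (BINDER row G-an2-4 OWNER; CRUX PROVER on C-R8° CT-ROUTE), gen 37, 2026-08-23.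
-/

noncomputable section

open Finset
open scoped BigOperators
open Literature.MathematicalPhysics.QuantumFieldTheory
open Literature.MathematicalPhysics.QuantumFieldTheory.LatticeForm (quo)
open Literature.MathematicalPhysics.QuantumFieldTheory.Balaban1983to89
open Literature.MathematicalPhysics.QuantumFieldTheory.Balaban1983to89.Beta
open B4ContourShift (supNorm supNorm_nonneg)
open B12Sec2to5 (l1 l1_nonneg)
open ExpKernelCalculus (MKer Decays Zl Zl_nonneg)
open OneStepResolventKernel (Fib quo_zsmul)
open OneStepKernelFamily (KInvStep)
open AffineAveraging (Site box toSite)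
open Summit.QuantumFields.BalabanUV.Beta.HessKerDressedUnits (unitK decays_unitK)
open Summit.QuantumFields.BalabanUV.Beta.HessKerCoDressedBmWall (unitK_coDressKBmAt)
open Summit.QuantumFields.BalabanUV.Beta.AxialDressingRooted (coDressKBmAt decays_coDressKBmAt_KInvStep)
open Summit.QuantumFields.BalabanUV.Beta.GAN24.CombesThomas (sfStep smStep sfStep_ne_zero smStep_ne_zero)
open Summit.QuantumFields.BalabanUV.Beta.GAN24.KSlotAssembly (convCK_holds)
open Summit.QuantumFields.BalabanUV.Beta.GAN24.Push4 (legComp legComp_apply rowM rowM_apply)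
open Summit.QuantumFields.BalabanUV.Beta.GAN24.Push4Bounds (LegDecay)
open Summit.QuantumFields.BalabanUV.Beta.GAN24.Push4Iter (LegFam legChain legChain_zero legChain_succ)
open Summit.QuantumFields.BalabanUV.Beta.GAN24.LegCompAssoc (legChain_succ_left)
open Summit.QuantumFields.BalabanUV.Beta.GAN24.CarrierSlotLegBottomKernel (legChain_congr_from)
open Summit.QuantumFields.BalabanUV.Beta.GAN24.Push4LegTelescopeComb (rowM_coDress_seq legChain_neg)
open Summit.QuantumFields.BalabanUV.Beta.GAN24.RespStepBmDecompExact (respStepBmSeq)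
open Summit.QuantumFields.BalabanUV.Beta.GAN24.LegStepPush (krow supNorm_sub_comm)
open Summit.QuantumFields.BalabanUV.Beta.GAN24.LegPushNestAux (kcomp)
open Summit.QuantumFields.BalabanUV.Beta.GAN24.LegChainPush (kChain kChain_zero kChain_succ klegDecay_krow)
open Summit.QuantumFields.BalabanUV.Beta.GAN24.DressedLegBlockL1Envelope (exists_legChain_blockL1_envelope)
open Summit.QuantumFields.BalabanUV.Beta.GAN24.DressedLegBlockL1MultiplierColumn (unitK_coDressKBmAt_inr_inr sum_box_exp_decay_le)
open Summit.QuantumFields.BalabanUV.Beta.GAN24.DressedLegMultiplierColumnEnvelope (exists_legChain_mmColumn_blockL1_envelope)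

namespace Summit.QuantumFields.BalabanUV.Beta.GAN24.CarrierKernelLegBlockL1

variable {d : ℕ}

/-! ## §1 The composite full-row leg through the field columns is a `legChain`; the chain unrolls at the fine end too -/

/-- [folklore] **AT A FIELD COLUMN, `kChain` IS `Push4Iter.legChain` OF THE FIELD-COLUMN FAMILIES** — the two recursions coincide:
`kChain l m k α x″ (inl κ) x = legChain (j ↦ (α x″ α′ x′ ↦ l j α x″ (inl α′) x′)) m k α x″ κ x`. -/
theorem kChain_inl_eq_legChain (l : ℕ → Fin (d + 1) → (Fin (d + 1) → ℤ) → Fib d → (Fin (d + 1) → ℤ) → ℝ) (m : ℕ) :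
    ∀ (k : ℕ) (α : Fin (d + 1)) (x'' : Fin (d + 1) → ℤ) (κ : Fin (d + 1)) (x : Fin (d + 1) → ℤ),
      kChain l m k α x'' (Sum.inl κ) x = legChain (fun j => fun α x'' α' x' => l j α x'' (Sum.inl α') x') m k α x'' κ x
  | 0, α, x'', κ, x => by rw [kChain_zero, legChain_zero]
  | k + 1, α, x'', κ, x => by
    simp only [kChain_succ, legChain_succ, kcomp, legComp_apply, kChain_inl_eq_legChain l m k]

/-- [folklore] **THE FREE COLUMN FIBRE CAN BE FROZEN INTO THE LEVEL-`m` LEG**: with `l′ := update l m (α x′ _ x ↦ l m α x′ f x)`,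
`kChain l m k α x″ f x = kChain l′ m k α x″ (inl κ) x` (any dummy `κ`; the levels `> m` are read at field columns only). -/
theorem kChain_eq_kChain_update (l : ℕ → Fin (d + 1) → (Fin (d + 1) → ℤ) → Fib d → (Fin (d + 1) → ℤ) → ℝ) (m : ℕ) (f : Fib d) (κ : Fin (d + 1)) :
    ∀ (k : ℕ) (α : Fin (d + 1)) (x'' x : Fin (d + 1) → ℤ),
      kChain l m k α x'' f x = kChain (Function.update l m (fun α x' _ x => l m α x' f x)) m k α x'' (Sum.inl κ) x
  | 0, α, x'', x => by simp only [kChain_zero, Function.update_self]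
  | k + 1, α, x'', x => by
    simp only [kChain_succ, kcomp, Function.update_of_ne (show m + k + 1 ≠ m by omega), kChain_eq_kChain_update l m f κ k]

/-- NOT IN PRINT; OUR BOOKKEEPING.  **THE COMPOSITE FULL-ROW LEG UNROLLS AT ITS FINE END TOO**: for levelwise localised full-row legs (`1 ≤ N`),
`kChain l m (k+1) α x″ f x = Σ′_{x′} Σ_{α′} legChain (j ↦ field columns of l j) (m+1) k α x″ α′ x′ · l m α′ x′ f x` — §1 ⨾ the fibre frozen into level `m` ⨾ leaf-03 g55's
`LegCompAssoc.legChain_succ_left` (the one Fubini, `legComp_assoc`). -/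
theorem kChain_succ_left {l : ℕ → Fin (d + 1) → (Fin (d + 1) → ℤ) → Fib d → (Fin (d + 1) → ℤ) → ℝ} {N : ℕ} (hN : 1 ≤ N)
    (hl : ∀ j, ∃ C μ : ℝ, 0 < μ ∧ ∀ α x' g x, |l j α x' g x| ≤ C * Real.exp (-μ * l1 (x - (N : ℤ) • x')))
    (m k : ℕ) (α : Fin (d + 1)) (x'' : Fin (d + 1) → ℤ) (f : Fib d) (x : Fin (d + 1) → ℤ) :
    kChain l m (k + 1) α x'' f x
      = ∑' x', ∑ α' : Fin (d + 1), legChain (fun j => fun α x'' α' x' => l j α x'' (Sum.inl α') x') (m + 1) k α x'' α' x' * l m α' x' f x := by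
  rw [kChain_eq_kChain_update l m f 0 (k + 1) α x'' x, kChain_inl_eq_legChain]
  set R' : ℕ → LegFam d := fun j => fun α x'' α' x' => Function.update l m (fun α x' (_ : Fib d) x => l m α x' f x) j α x'' (Sum.inl α') x' with hR'
  have hdec : ∀ j, ∃ C μ : ℝ, 0 < μ ∧ LegDecay (R' j) N C μ := by
    intro j
    by_cases hj : j = m
    · obtain ⟨C, μ, hμ, h⟩ := hl m
      refine ⟨C, μ, hμ, fun α x'' α' x' => ?_⟩
      subst hj
      simp only [hR', Function.update_self]
      exact h α x'' f x'
    · obtain ⟨C, μ, hμ, h⟩ := hl j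
      refine ⟨C, μ, hμ, fun α x'' α' x' => ?_⟩
      simp only [hR', Function.update_of_ne hj]
      exact h α x'' (Sum.inl α') x'
  have hcongr : legChain R' (m + 1) k = legChain (fun j => fun α x'' α' x' => l j α x'' (Sum.inl α') x') (m + 1) k :=
    legChain_congr_from (fun j hj => by
      have hjm : j ≠ m := by omega
      simp only [hR', Function.update_of_ne hjm]) k
  rw [legChain_succ_left hN hdec m k, legComp_apply, hcongr]
  simp only [hR', Function.update_self]

/-! ## §2 The dressed unit step kernels of the socket -/

section Dressed

variable {Lc : ℕ} [NeZero Lc]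

/-- [folklore] **THE FIELD COLUMNS OF THE DRESSED FULL ROW ARE `−respStepBmSeq`**: `krow K♮ᴱ_j Lc α x″ (inl α′) x′ = rowM (Πᵀ K̃_j Π) Lc α x″ α′ x′ = −respStepBm ρ Lc (Lc^j) (Lc^{j+1}) α x″ α′ x′`
(asym1's `unitK_coDressKBmAt` ⨾ leaf-01 g43's `rowM_coDressKBmAt_KStepUnit` via leaf-03's `rowM_coDress_seq`). -/
theorem krowInl_dressed_seq (ρ : Fin (d + 1) → ℤ) :
    (fun j => fun (α : Fin (d + 1)) (x'' : Fin (d + 1) → ℤ) (α' : Fin (d + 1)) (x' : Fin (d + 1) → ℤ) =>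
        krow (unitK (sfStep Lc j) (smStep d Lc j) (coDressKBmAt ρ Lc (KInvStep (d := d) Lc j))) Lc α x'' (Sum.inl α') x')
      = fun j => -respStepBmSeq (d := d) ρ Lc j := by
  funext j α x'' α' x'
  have h := congrFun (congrFun (congrFun (congrFun (congrFun (rowM_coDress_seq (d := d) (Lc := Lc) ρ) j) α) x'') α') x'
  rw [rowM_apply] at h
  rw [krow, unitK_coDressKBmAt ρ Lc (sfStep_ne_zero j) (smStep_ne_zero j)]
  exact h

/-- [folklore] **THE MULTIPLIER COLUMNS OF THE DRESSED FULL ROW ARE THE UNDRESSED UNIT KERNEL's** (part 3a's `unitK_coDressKBmAt_inr_inr`):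
`krow K♮ᴱ_j Lc α x″ (inr β) x = K̃_j (Lc•x″) x (inr α) (inr β)`. -/
theorem krow_dressed_inr (ρ : Fin (d + 1) → ℤ) (j : ℕ) (α : Fin (d + 1)) (x'' : Fin (d + 1) → ℤ) (β : Fin (d + 1)) (x : Fin (d + 1) → ℤ) :
    krow (unitK (sfStep Lc j) (smStep d Lc j) (coDressKBmAt ρ Lc (KInvStep (d := d) Lc j))) Lc α x'' (Sum.inr β) x
      = unitK (sfStep Lc j) (smStep d Lc j) (KInvStep (d := d) Lc j) ((Lc : ℤ) • x'') x (Sum.inr α) (Sum.inr β) := by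
  rw [krow, unitK_coDressKBmAt_inr_inr]

/-- [folklore] The dressed unit step kernels decay at positive rates (asym1's `decays_coDressKBmAt_KInvStep` ⨾ an5's `decays_unitK`). -/
theorem decays_dressedStep {rr : Fin (d + 1) → ℕ} (hrr : rr ∈ box (d + 1) Lc) (j : ℕ) :
    ∃ C μ : ℝ, 0 < μ ∧ Decays (unitK (sfStep Lc j) (smStep d Lc j) (coDressKBmAt (toSite rr) Lc (KInvStep (d := d) Lc j))) C μ := by
  obtain ⟨δ, C, hδ, -, hK⟩ := decays_coDressKBmAt_KInvStep (d := d) hrr j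
  exact ⟨_, δ, hδ, decays_unitK hK⟩

/-- [folklore] … hence their full rows are levelwise localised full-row legs (leaf-01's `klegDecay_krow`). -/
theorem klegDecay_krow_dressed {rr : Fin (d + 1) → ℕ} (hrr : rr ∈ box (d + 1) Lc) :
    ∀ j, ∃ C μ : ℝ, 0 < μ ∧ ∀ (α : Fin (d + 1)) (x' : Fin (d + 1) → ℤ) (g : Fib d) (x : Fin (d + 1) → ℤ),
      |krow (unitK (sfStep Lc j) (smStep d Lc j) (coDressKBmAt (toSite rr) Lc (KInvStep (d := d) Lc j))) Lc α x' g x|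
        ≤ C * Real.exp (-μ * l1 (x - (Lc : ℤ) • x')) := fun j => by
  obtain ⟨C, μ, hμ, hK⟩ := decays_dressedStep (d := d) hrr j
  exact ⟨C, μ, hμ, fun α x' g x => klegDecay_krow hK Lc α x' g x⟩

/-- NOT IN PRINT; OUR BOOKKEEPING.  **THE FIELD COLUMNS OF THE CARRIER's COMPOSITE KERNEL LEG ARE THE DRESSED ROW CHAIN, UP TO SIGN**:
`kChain (j ↦ krow K♮ᴱ_j Lc) m k α x″ (inl κ) x = (−1)^{k+1} · legChain (respStepBmSeq ρ Lc) m k α x″ κ x` (§1 ⨾ `krowInl_dressed_seq` ⨾ `legChain_neg`). -/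
theorem kChain_dressed_inl (ρ : Fin (d + 1) → ℤ) (m k : ℕ) (α : Fin (d + 1)) (x'' : Fin (d + 1) → ℤ) (κ : Fin (d + 1)) (x : Fin (d + 1) → ℤ) :
    kChain (fun j => krow (unitK (sfStep Lc j) (smStep d Lc j) (coDressKBmAt ρ Lc (KInvStep (d := d) Lc j))) Lc) m k α x'' (Sum.inl κ) x
      = (-1 : ℝ) ^ (k + 1) * legChain (respStepBmSeq (d := d) ρ Lc) m k α x'' κ x := by
  rw [kChain_inl_eq_legChain, krowInl_dressed_seq, legChain_neg]
  rfl

/-- NOT IN PRINT; OUR BOOKKEEPING.  **THE MULTIPLIER COLUMNS OF THE CARRIER's COMPOSITE KERNEL LEG (WINDOWS OF LENGTH ≥ 2) ARE PART 3b's OBJECT, UP TO SIGN**: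
`kChain (j ↦ krow K♮ᴱ_j Lc) m (k+1) α x″ (inr β) x = (−1)^{k+1} · Σ′_{x′} Σ_{α′} legChain (respStepBmSeq ρ Lc) (m+1) k α x″ α′ x′ · K̃_m (Lc•x′) x (inr α′) (inr β)`
(`kChain_succ_left` ⨾ `krowInl_dressed_seq` ⨾ `legChain_neg` ⨾ `krow_dressed_inr`). -/
theorem kChain_dressed_inr_succ (hLc : 1 ≤ Lc) {rr : Fin (d + 1) → ℕ} (hrr : rr ∈ box (d + 1) Lc) (m k : ℕ) (α : Fin (d + 1)) (x'' : Fin (d + 1) → ℤ)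
    (β : Fin (d + 1)) (x : Fin (d + 1) → ℤ) :
    kChain (fun j => krow (unitK (sfStep Lc j) (smStep d Lc j) (coDressKBmAt (toSite rr) Lc (KInvStep (d := d) Lc j))) Lc) m (k + 1) α x'' (Sum.inr β) x
      = (-1 : ℝ) ^ (k + 1) * ∑' x', ∑ α' : Fin (d + 1), legChain (respStepBmSeq (d := d) (toSite rr) Lc) (m + 1) k α x'' α' x' *
          unitK (sfStep Lc m) (smStep d Lc m) (KInvStep (d := d) Lc m) ((Lc : ℤ) • x') x (Sum.inr α') (Sum.inr β) := by
  rw [kChain_succ_left hLc (klegDecay_krow_dressed (d := d) hrr) m k, krowInl_dressed_seq, legChain_neg, ← tsum_mul_left]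
  refine tsum_congr fun x' => ?_
  simp only [Pi.smul_apply, smul_eq_mul, krow_dressed_inr, Finset.mul_sum, mul_assoc]

end Dressed

/-! ## §3 The block mass of the carrier's composite kernel leg (`d = 3`) -/

section Three

variable {Lc : ℕ} [NeZero Lc]

/-- [folklore] **A WINDOW OF LENGTH ONE AT A MULTIPLIER COLUMN**: for a kernel row with `|M x′ x| ≤ CK·e^{−δK|Lc•x′ − x|₁}` (the K-slot's decay), `0 ≤ κ₁`, `4κ₁ ≤ δK`, `1 ≤ Lc`:
`Σ_{t ∈ box Lc} |M x″ (Lc•c + t)| ≤ CK·Zl(δK∕2)·e^{2κ₁}·e^{−2κ₁‖x″ − c‖∞}` (part 3a's `sum_box_exp_decay_le` at blocking `Lc`, `quo_Lc (Lc•x″) = x″`). -/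
theorem sum_box_abs_mm_le (hLc : 1 ≤ Lc) {κ₁ δK CK : ℝ} (hκ : 0 ≤ κ₁) (hδK : 0 < δK) (h4 : 4 * κ₁ ≤ δK) (hCK : 0 ≤ CK)
    {M : (Fin (d + 1) → ℤ) → (Fin (d + 1) → ℤ) → ℝ} (hM : ∀ x' x, |M x' x| ≤ CK * Real.exp (-δK * l1 ((Lc : ℤ) • x' - x)))
    (x'' c : Fin (d + 1) → ℤ) :
    ∑ t ∈ box (d + 1) Lc, |M x'' ((Lc : ℤ) • c + toSite t)| ≤ CK * Zl (d + 1) (δK / 2) * Real.exp (2 * κ₁) * Real.exp (-(2 * κ₁) * supNorm (x'' - c)) := by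
  have h := sum_box_exp_decay_le (d := d) hLc hκ hδK h4 ((Lc : ℤ) • x'') c
  rw [quo_zsmul] at h
  calc ∑ t ∈ box (d + 1) Lc, |M x'' ((Lc : ℤ) • c + toSite t)|
      ≤ ∑ t ∈ box (d + 1) Lc, CK * Real.exp (-δK * l1 ((Lc : ℤ) • x'' - ((Lc : ℤ) • c + toSite t))) := Finset.sum_le_sum fun t _ => hM x'' _
    _ = CK * ∑ t ∈ box (d + 1) Lc, Real.exp (-δK * l1 ((Lc : ℤ) • x'' - ((Lc : ℤ) • c + toSite t))) := by rw [Finset.mul_sum]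
    _ ≤ CK * (Zl (d + 1) (δK / 2) * Real.exp (2 * κ₁) * Real.exp (-(2 * κ₁) * supNorm (x'' - c))) := mul_le_mul_of_nonneg_left h hCK
    _ = _ := by ring

/-- NOT IN PRINT; OUR BOOKKEEPING.  **THE CARRIER's COMPOSITE KERNEL LEG IS `T^B`-SIZED IN BLOCK MASS — ALL COLUMN FIBRES, UNIFORMLY IN THE PAIR OF LEVELS** (`d = 3`,
`2 ≤ Lc`, in-block root; as displayed in the module docstring): the `hl₁` of leaf-01 g74's `locStencil₂_legChain_bsumPow_of_dressed_envelopes_of_blockL1` for the socket's own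
dressed kernels, with `a_ρ·L^{d+1} := K″·(k+1)·(Lc^{k+1})⁻¹` at window length `k+1`. -/
theorem exists_kChain_dressed_blockMass (hLc : 2 ≤ Lc) :
    ∃ κ₁ K'' : ℝ, 0 < κ₁ ∧ 0 ≤ K'' ∧ ∀ (rr : Fin (3 + 1) → ℕ), rr ∈ box (3 + 1) Lc →
      ∀ (m k : ℕ) (α : Fin (3 + 1)) (x'' : Site (3 + 1)) (f : Fib 3) (c : Site (3 + 1)),
        ∑ t ∈ box (3 + 1) (Lc ^ (k + 1)),
            |kChain (fun j => krow (unitK (sfStep Lc j) (smStep 3 Lc j) (coDressKBmAt (toSite rr) Lc (KInvStep (d := 3) Lc j))) Lc) m k α x'' f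
                (((Lc ^ (k + 1) : ℕ) : ℤ) • c + toSite t)|
          ≤ K'' * ((k : ℝ) + 1) * ((Lc : ℝ) ^ (k + 1))⁻¹ * Real.exp (-(κ₁ * supNorm (c - x''))) := by
  classical
  have hLc1 : 1 ≤ Lc := le_trans (by norm_num) hLc
  have hLpos : (0 : ℝ) < (Lc : ℝ) := by exact_mod_cast (show 0 < Lc by omega)
  obtain ⟨κ₀, K, hκ₀, hK, hlaw⟩ := exists_legChain_blockL1_envelope (Lc := Lc)
  obtain ⟨κ₂, K', hκ₂, hK', hlaw'⟩ := exists_legChain_mmColumn_blockL1_envelope (Lc := Lc) hLc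
  obtain ⟨CK, δK, cc, θ, hδK, -, -, hU, -⟩ := convCK_holds (Lc := Lc) hLc
  have hCK : 0 ≤ CK := by
    have h := hU 0 0 0 (Sum.inl 0) (Sum.inl 0)
    have h0 : (0 : ℝ) ≤ CK * Real.exp (-δK * l1 ((0 : Site (3 + 1)) - 0)) := (abs_nonneg _).trans h
    rw [sub_self] at h0
    have : l1 (0 : Site (3 + 1)) = 0 := by unfold l1; simp
    rw [this, mul_zero, Real.exp_zero, mul_one] at h0
    exact h0
  set κ₁ : ℝ := min (min κ₀ κ₂) (δK / 4) with hκ₁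
  have hκ₁0 : 0 < κ₁ := lt_min (lt_min hκ₀ hκ₂) (by positivity)
  have hκ₁κ₀ : κ₁ ≤ κ₀ := (min_le_left _ _).trans (min_le_left _ _)
  have hκ₁κ₂ : κ₁ ≤ κ₂ := (min_le_left _ _).trans (min_le_right _ _)
  have h4 : 4 * κ₁ ≤ δK := by have := min_le_right (min κ₀ κ₂) (δK / 4); rw [← hκ₁] at this; linarith
  have hZ := Zl_nonneg (D := 3 + 1) (show 0 < δK / 2 by positivity)
  set K'' : ℝ := K + K' * Lc + CK * Zl (3 + 1) (δK / 2) * Real.exp (2 * κ₁) * Lc with hK''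
  have hK''0 : 0 ≤ K'' := by
    rw [hK'']
    have hP1 : 0 ≤ K' * Lc := mul_nonneg hK' hLpos.le
    have hP2 : 0 ≤ CK * Zl (3 + 1) (δK / 2) * Real.exp (2 * κ₁) * Lc :=
      mul_nonneg (mul_nonneg (mul_nonneg hCK hZ) (Real.exp_pos (2 * κ₁)).le) hLpos.le
    linarith
  have hP1 : 0 ≤ K' * Lc := mul_nonneg hK' hLpos.le
  have hP2 : 0 ≤ CK * Zl (3 + 1) (δK / 2) * Real.exp (2 * κ₁) * Lc :=
    mul_nonneg (mul_nonneg (mul_nonneg hCK hZ) (Real.exp_pos (2 * κ₁)).le) hLpos.le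
  have hKle : K ≤ K'' := by rw [hK'']; linarith
  have hK'le : K' * Lc ≤ K'' := by rw [hK'']; linarith
  have hCle : CK * Zl (3 + 1) (δK / 2) * Real.exp (2 * κ₁) * Lc ≤ K'' := by rw [hK'']; linarith
  have hLne : (Lc : ℝ) ≠ 0 := hLpos.ne'
  -- rate weakening
  have hexp : ∀ {κ : ℝ} (s : ℝ), 0 ≤ s → κ₁ ≤ κ → Real.exp (-(κ * s)) ≤ Real.exp (-(κ₁ * s)) := fun s hs hκ => by
    rw [Real.exp_le_exp]; nlinarith
  refine ⟨κ₁, K'', hκ₁0, hK''0, ?_⟩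
  intro rr hrr m k α x'' f c
  have hs : 0 ≤ supNorm (c - x'') := supNorm_nonneg _
  have hkpos : (0 : ℝ) ≤ (k : ℝ) + 1 := by positivity
  have hLk : (0 : ℝ) < ((Lc : ℝ) ^ (k + 1))⁻¹ := by positivity
  rcases f with κ | β
  · -- field columns: part 2's law for the dressed row chain (the sign is invisible to the block mass)
    have e : ∀ t, |kChain (fun j => krow (unitK (sfStep Lc j) (smStep 3 Lc j) (coDressKBmAt (toSite rr) Lc (KInvStep (d := 3) Lc j))) Lc) m k α x''
          (Sum.inl κ) (((Lc ^ (k + 1) : ℕ) : ℤ) • c + toSite t)|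
        = |legChain (respStepBmSeq (d := 3) (toSite rr) Lc) m k α x'' κ (((Lc ^ (k + 1) : ℕ) : ℤ) • c + toSite t)| := fun t => by
      rw [kChain_dressed_inl, abs_mul, abs_pow, abs_neg, abs_one, one_pow, one_mul]
    simp only [e]
    refine (hlaw rr hrr m k α x'' κ c).trans ?_
    have h1 : K * ((k : ℝ) + 1) * ((Lc : ℝ) ^ (k + 1))⁻¹ ≤ K'' * ((k : ℝ) + 1) * ((Lc : ℝ) ^ (k + 1))⁻¹ :=
      mul_le_mul_of_nonneg_right (mul_le_mul_of_nonneg_right hKle hkpos) hLk.le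
    exact mul_le_mul h1 (hexp _ hs hκ₁κ₀) (Real.exp_pos _).le (mul_nonneg (mul_nonneg hK''0 hkpos) hLk.le)
  · cases k with
    | zero =>
      -- a window of length one: the mm block of `K̃_m` alone, block-summed at blocking `Lc`
      simp only [kChain_zero, krow_dressed_inr, zero_add, pow_one, Nat.cast_zero, mul_one]
      have hM : ∀ x' x, |unitK (sfStep Lc m) (smStep 3 Lc m) (KInvStep (d := 3) Lc m) ((Lc : ℤ) • x') x (Sum.inr α) (Sum.inr β)|
          ≤ CK * Real.exp (-δK * l1 ((Lc : ℤ) • x' - x)) := fun x' x => hU m _ _ _ _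
      refine (sum_box_abs_mm_le (d := 3) hLc1 hκ₁0.le hδK h4 hCK hM x'' c).trans ?_
      rw [supNorm_sub_comm c x'']
      have h1 : CK * Zl (3 + 1) (δK / 2) * Real.exp (2 * κ₁) ≤ K'' * ((Lc : ℝ))⁻¹ := by
        have e1 : CK * Zl (3 + 1) (δK / 2) * Real.exp (2 * κ₁) = (CK * Zl (3 + 1) (δK / 2) * Real.exp (2 * κ₁) * Lc) * ((Lc : ℝ))⁻¹ := by
          field_simp
        rw [e1]
        exact mul_le_mul_of_nonneg_right hCle (inv_nonneg.2 hLpos.le)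
      have h2 : Real.exp (-(2 * κ₁) * supNorm (c - x'')) ≤ Real.exp (-(κ₁ * supNorm (c - x''))) := by
        rw [Real.exp_le_exp]; nlinarith
      exact mul_le_mul h1 h2 (Real.exp_pos _).le (mul_nonneg hK''0 (inv_nonneg.2 hLpos.le))
    | succ k =>
      -- windows of length ≥ 2 at a multiplier column: part 3b's law (the sign is invisible)
      have e : ∀ t, |kChain (fun j => krow (unitK (sfStep Lc j) (smStep 3 Lc j) (coDressKBmAt (toSite rr) Lc (KInvStep (d := 3) Lc j))) Lc) m (k + 1) α x''
            (Sum.inr β) (((Lc ^ (k + 1 + 1) : ℕ) : ℤ) • c + toSite t)|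
          = |∑' x', ∑ α' : Fin (3 + 1), legChain (respStepBmSeq (d := 3) (toSite rr) Lc) (m + 1) k α x'' α' x' *
              unitK (sfStep Lc m) (smStep 3 Lc m) (KInvStep (d := 3) Lc m) ((Lc : ℤ) • x') (((Lc ^ (k + 2) : ℕ) : ℤ) • c + toSite t) (Sum.inr α') (Sum.inr β)| :=
        fun t => by rw [kChain_dressed_inr_succ hLc1 hrr, abs_mul, abs_pow, abs_neg, abs_one, one_pow, one_mul]
      simp only [e]
      refine (hlaw' rr hrr m k α x'' β c).trans ?_
      -- `K′·(k+1)·(Lc^{k+1})⁻¹ ≤ (K′·Lc)·(k+2)·(Lc^{k+2})⁻¹ ≤ K″·(k+2)·(Lc^{k+2})⁻¹`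
      have hLk2 : (0 : ℝ) < ((Lc : ℝ) ^ (k + 1 + 1))⁻¹ := by positivity
      have e2 : K' * Lc * ((Lc : ℝ) ^ (k + 1 + 1))⁻¹ = K' * ((Lc : ℝ) ^ (k + 1))⁻¹ := by
        rw [pow_succ]; field_simp
      have h1 : K' * ((k : ℝ) + 1) * ((Lc : ℝ) ^ (k + 1))⁻¹ ≤ K'' * (((k + 1 : ℕ) : ℝ) + 1) * ((Lc : ℝ) ^ (k + 1 + 1))⁻¹ := by
        calc K' * ((k : ℝ) + 1) * ((Lc : ℝ) ^ (k + 1))⁻¹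
            = (K' * Lc * ((Lc : ℝ) ^ (k + 1 + 1))⁻¹) * ((k : ℝ) + 1) := by rw [e2]; ring
          _ ≤ (K'' * ((Lc : ℝ) ^ (k + 1 + 1))⁻¹) * (((k + 1 : ℕ) : ℝ) + 1) := by
              refine mul_le_mul (mul_le_mul_of_nonneg_right hK'le hLk2.le) ?_ (by positivity) (mul_nonneg hK''0 hLk2.le)
              push_cast; linarith
          _ = _ := by ring
      exact mul_le_mul h1 (hexp _ hs hκ₁κ₂) (Real.exp_pos _).le (mul_nonneg (mul_nonneg hK''0 (by positivity)) hLk2.le)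

end Three

end Summit.QuantumFields.BalabanUV.Beta.GAN24.CarrierKernelLegBlockL1

end
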